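import Mathlib
import Summits.MatrixMultiplication.MatrixMultiplication.Theorems.FidelityWitnessesRankTwoAdditivityTheoremA
import Summits.MatrixMultiplication.MatrixMultiplication.Theorems.FidelityWitnessesRankTwoAdditivityTransport

/-!
# `FidelityWitnesses.RankTwoAdditivity` (stmt-MatrixMultiplication-4964) — the unit certificate

`lmi_unit`: for unit `Y₁, Y₂` with `|⟨Y₁,Y₂⟩| < 1` and `|x| < 1` there is `p'` such that the explicit Hermitian
2×2 matrix `ζ_B(p') = (1−p')(1−|xy|²)Γ_X⁻¹ + p'(1 − |y|² σ_x)` satisfies `ζ_B(p') ⊗ 1 ⪰ 𝐍̃` (stated as a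
pointwise inequality of Hermitian forms) — the transport of Theorem A along the explicit frames.
Supports item `stmt-MatrixMultiplication-4964`; no definitions are introduced.
-/

namespace Summit.MatrixMultiplication.MatrixMultiplication.Theorems.RankTwoAdditivity

open scoped BigOperators ComplexConjugate

/-- The scalar bookkeeping at the end of the transport: from the Theorem-A inequality in closed form to the
certificate inequality (multiply by `1 − |xy|²`). -/
theorem transport_algebra (p' X Yn A B Cr n1 n2 qr : ℝ) (hX1 : X < 1) (hYX1 : Yn * X < 1)
    (hA : A + (1 - Yn * X)⁻¹ * (B + Yn * X * A - 2 * Cr)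
      ≤ (1 - p') * (n1 + (1 - X)⁻¹ * (n2 + X * n1 - 2 * qr))
        + p' * (n1 + ((1 - Yn * X)⁻¹ * Yn * (n2 + X * n1 - 2 * qr) + (1 - Yn * X)⁻¹ * (1 - Yn) * n2))) :
    A + B - 2 * Cr
      ≤ ((1 - p') * (1 - Yn * X) / (1 - X) + p') * (n1 + n2)
        + 2 * (-(((1 - p') * (1 - Yn * X) / (1 - X) + p' * Yn)) * qr) := by
  have h1 : 0 < 1 - Yn * X := by linarith
  have h2 : 0 < 1 - X := by linarith
  have hA' := mul_le_mul_of_nonneg_left hA h1.le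
  have key : ((1 - p') * (1 - Yn * X) / (1 - X) + p') * (n1 + n2)
        + 2 * (-(((1 - p') * (1 - Yn * X) / (1 - X) + p' * Yn)) * qr) - (A + B - 2 * Cr)
      = (1 - Yn * X) * ((1 - p') * (n1 + (1 - X)⁻¹ * (n2 + X * n1 - 2 * qr))
          + p' * (n1 + ((1 - Yn * X)⁻¹ * Yn * (n2 + X * n1 - 2 * qr) + (1 - Yn * X)⁻¹ * (1 - Yn) * n2)))
        - (1 - Yn * X) * (A + (1 - Yn * X)⁻¹ * (B + Yn * X * A - 2 * Cr)) := by
    field_simp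
    ring
  nlinarith [key, hA']

/-- **The unit certificate (transport of Theorem A).** For unit `v₁, v₂ : κ × μ → ℂ` with `y = ⟨v₁,v₂⟩`,
`|y| < 1`, and `x : ℂ` with `|x| < 1`, there is `p' : ℝ` such that for all `ψ₁ ψ₂ : κ → ℂ`
`‖Y₁*ψ₁‖² + ‖Y₂*ψ₂‖² − 2Re(conj(xy)⟨Y₂*ψ₂, Y₁*ψ₁⟩) ≤ D(‖ψ₁‖² + ‖ψ₂‖²) + 2Re(O ⟨ψ₂,ψ₁⟩)` with
`D = (1−p')(1−|xy|²)/(1−|x|²) + p'`, `O = −conj(x)((1−p')(1−|xy|²)/(1−|x|²) + p'|y|²)`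
(the form of `ζ_B(p') ⊗ 1 ⪰ 𝐍̃` used by `core_of_certificate`). -/
theorem lmi_unit {κ μ : Type*} [Fintype κ] [Fintype μ]
    (v₁ v₂ : κ × μ → ℂ) (h₁ : (∑ c, ‖v₁ c‖ ^ 2) = 1) (h₂ : (∑ c, ‖v₂ c‖ ^ 2) = 1)
    (hy : ‖∑ c, conj (v₁ c) * v₂ c‖ < 1) (x : ℂ) (hx : ‖x‖ < 1) :
    ∃ p' : ℝ, ∀ ψ₁ ψ₂ : κ → ℂ,
      (∑ c, ‖∑ m, conj (v₁ (m, c)) * ψ₁ m‖ ^ 2) + (∑ c, ‖∑ m, conj (v₂ (m, c)) * ψ₂ m‖ ^ 2)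
        - 2 * (conj (x * ∑ c, conj (v₁ c) * v₂ c)
            * ∑ c, conj (∑ m, conj (v₂ (m, c)) * ψ₂ m) * ∑ m, conj (v₁ (m, c)) * ψ₁ m).re
      ≤ ((1 - p') * (1 - ‖x * ∑ c, conj (v₁ c) * v₂ c‖ ^ 2) / (1 - ‖x‖ ^ 2) + p')
            * ((∑ m, ‖ψ₁ m‖ ^ 2) + ∑ m, ‖ψ₂ m‖ ^ 2)
        + 2 * ((-(conj x * ((((1 - p') * (1 - ‖x * ∑ c, conj (v₁ c) * v₂ c‖ ^ 2) / (1 - ‖x‖ ^ 2)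
              + p' * ‖∑ c, conj (v₁ c) * v₂ c‖ ^ 2 : ℝ)) : ℂ))) * ∑ m, conj (ψ₂ m) * ψ₁ m).re := by
  classical
  set y : ℂ := ∑ c, conj (v₁ c) * v₂ c with hydef
  -- frames
  obtain ⟨hQ, hτpos, hτ2, hv₂⟩ := frameQ v₁ v₂ h₁ h₂ hy
  set τ : ℝ := Real.sqrt (1 - ‖y‖ ^ 2) with hτdef
  set Q : Fin 2 → κ × μ → ℂ := fun k c => if k = 0 then v₁ c else (τ : ℂ)⁻¹ * (v₂ c - y * v₁ c) with hQdef
  set σ : ℝ := Real.sqrt (1 - ‖x‖ ^ 2) with hσdef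
  have hσ2 : σ ^ 2 = 1 - ‖x‖ ^ 2 := Real.sq_sqrt (by nlinarith [norm_nonneg x])
  have hσpos : 0 < σ := Real.sqrt_pos.2 (by nlinarith [norm_nonneg x])
  have hpx : ‖y * x‖ < 1 := by
    rw [norm_mul]
    nlinarith [norm_nonneg y, norm_nonneg x]
  obtain ⟨hw, hρpos, hρ2⟩ := frameW y x τ σ hτ2 hσ2 hpx
  set ρ : ℝ := Real.sqrt (1 - ‖y * x‖ ^ 2) with hρdef
  set T₂ : Fin 2 × Fin 2 → ℂ := fun a =>
    (if a.1 = 0 then y else (τ : ℂ)) * (if a.2 = 0 then x else (σ : ℂ)) with hT₂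
  set w : Fin 2 → Fin 2 × Fin 2 → ℂ := fun r a =>
    if r = 0 then (if a = (0, 0) then 1 else 0)
    else (ρ : ℂ)⁻¹ * (T₂ a - (y * x) * (if a = (0, 0) then 1 else 0)) with hwdef
  -- Theorem A
  obtain ⟨p', hp'⟩ := theoremA Q hQ w hw
  refine ⟨p', fun ψ₁ ψ₂ => ?_⟩
  -- the transported vector
  set φ : Fin 2 → κ → ℂ := fun i m => if i = 0 then ψ₁ m else (σ : ℂ)⁻¹ * (ψ₂ m - conj x * ψ₁ m) with hφ
  have hA := hp' φ
  rw [H_sos] at hA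
  -- nonvanishing scalars
  have hσne : (σ : ℂ) ≠ 0 := by exact_mod_cast hσpos.ne'
  have hτne : (τ : ℂ) ≠ 0 := by exact_mod_cast hτpos.ne'
  have hρne : (ρ : ℂ) ≠ 0 := by exact_mod_cast hρpos.ne'
  -- values of Q, φ, w
  have hQ0 : ∀ c, Q 0 c = v₁ c := fun c => by simp [hQdef]
  have hQ1 : ∀ c, Q 1 c = (τ : ℂ)⁻¹ * (v₂ c - y * v₁ c) := fun c => by simp [hQdef]
  have hφ0 : ∀ m, φ 0 m = ψ₁ m := fun m => by simp [hφ]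
  have hφ1 : ∀ m, φ 1 m = (σ : ℂ)⁻¹ * (ψ₂ m - conj x * ψ₁ m) := fun m => by simp [hφ]
  have w00 : w 0 (0, 0) = 1 := by simp [hwdef]
  have w01 : w 0 (0, 1) = 0 := by simp [hwdef]
  have w10 : w 0 (1, 0) = 0 := by simp [hwdef]
  have w11 : w 0 (1, 1) = 0 := by simp [hwdef]
  have u00 : w 1 (0, 0) = 0 := by simp [hwdef, hT₂]
  have u01 : w 1 (0, 1) = (ρ : ℂ)⁻¹ * (y * (σ : ℂ)) := by simp [hwdef, hT₂]
  have u10 : w 1 (1, 0) = (ρ : ℂ)⁻¹ * ((τ : ℂ) * x) := by simp [hwdef, hT₂]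
  have u11 : w 1 (1, 1) = (ρ : ℂ)⁻¹ * ((τ : ℂ) * (σ : ℂ)) := by simp [hwdef, hT₂]
  -- the two W's
  set W₁ : μ → ℂ := fun c => ∑ m, conj (v₁ (m, c)) * ψ₁ m with hW₁
  set W₂ : μ → ℂ := fun c => ∑ m, conj (v₂ (m, c)) * ψ₂ m with hW₂
  -- ∑_i conj(ξ i) φ i m = ψ₂ m  and  ∑_k η k Q k (m,c) = v₂ (m,c)
  have hξφ : ∀ m, conj x * φ 0 m + (σ : ℂ) * φ 1 m = ψ₂ m := by
    intro m; rw [hφ0, hφ1, ← mul_assoc, mul_inv_cancel₀ hσne, one_mul]; ring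
  have hηQ : ∀ m c, y * Q 0 (m, c) + (τ : ℂ) * Q 1 (m, c) = v₂ (m, c) := fun m c => (hv₂ (m, c)).symm
  -- g values needed
  have g00 : ∀ c, (∑ m, conj (Q 0 (m, c)) * φ 0 m) = W₁ c := by
    intro c; simp only [hQ0, hφ0, hW₁]
  have gT : ∀ c, (∑ a : Fin 2 × Fin 2, conj (T₂ a) * ∑ m, conj (Q a.1 (m, c)) * φ a.2 m) = W₂ c := by
    intro c
    -- = ∑ m conj(∑ k η k Q k (m,c)) (∑ i conj (ξ i) φ i m)
    have e : (∑ a : Fin 2 × Fin 2, conj (T₂ a) * ∑ m, conj (Q a.1 (m, c)) * φ a.2 m)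
        = ∑ m, conj (y * Q 0 (m, c) + (τ : ℂ) * Q 1 (m, c)) * (conj x * φ 0 m + (σ : ℂ) * φ 1 m) := by
      rw [Fintype.sum_prod_type]
      simp only [Fin.sum_univ_two, hT₂, if_true, show ((1 : Fin 2) = 0) = False from by decide, if_false,
        map_mul, map_add, Complex.conj_ofReal, Finset.mul_sum, ← Finset.sum_add_distrib]
      exact Finset.sum_congr rfl fun m _ => by ring
    rw [e, hW₂]
    exact Finset.sum_congr rfl fun m _ => by rw [hηQ, hξφ]
  -- G values
  have hG0 : ∀ c, (∑ a : Fin 2 × Fin 2, conj (w 0 a) * ∑ m, conj (Q a.1 (m, c)) * φ a.2 m) = W₁ c := by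
    intro c
    rw [Fintype.sum_prod_type]
    simp only [Fin.sum_univ_two, w00, w01, w10, w11, map_one, map_zero, one_mul, zero_mul, add_zero]
    exact g00 c
  have hG1 : ∀ c, (∑ a : Fin 2 × Fin 2, conj (w 1 a) * ∑ m, conj (Q a.1 (m, c)) * φ a.2 m)
      = (ρ : ℂ)⁻¹ * (W₂ c - conj (y * x) * W₁ c) := by
    intro c
    have e : ∀ a : Fin 2 × Fin 2, conj (w 1 a) = (ρ : ℂ)⁻¹ * (conj (T₂ a) - conj (y * x) * (if a = (0, 0) then 1 else 0)) := by
      intro a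
      simp only [hwdef, show ((1 : Fin 2) = 0) = False from by decide, if_false, map_mul, map_sub, map_inv₀,
        Complex.conj_ofReal]
      congr 2
      split_ifs <;> simp
    simp only [e]
    rw [show (∑ a : Fin 2 × Fin 2, (ρ : ℂ)⁻¹ * (conj (T₂ a) - conj (y * x) * (if a = (0, 0) then 1 else 0))
        * ∑ m, conj (Q a.1 (m, c)) * φ a.2 m)
      = (ρ : ℂ)⁻¹ * ((∑ a : Fin 2 × Fin 2, conj (T₂ a) * ∑ m, conj (Q a.1 (m, c)) * φ a.2 m)
        - conj (y * x) * ∑ a : Fin 2 × Fin 2, (if a = (0, 0) then (1:ℂ) else 0) * ∑ m, conj (Q a.1 (m, c)) * φ a.2 m) by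
      rw [mul_sub, Finset.mul_sum, Finset.mul_sum, Finset.mul_sum, ← Finset.sum_sub_distrib]
      exact Finset.sum_congr rfl fun a _ => by ring]
    rw [gT]
    congr 2
    have : (∑ a : Fin 2 × Fin 2, (if a = (0, 0) then (1:ℂ) else 0) * ∑ m, conj (Q a.1 (m, c)) * φ a.2 m) = W₁ c := by
      rw [Fintype.sum_prod_type]
      simp only [Fin.sum_univ_two, Prod.mk.injEq, if_true, one_mul, and_true, true_and,
        show ((1 : Fin 2) = 0) = False from by decide, if_false, zero_mul, add_zero, and_self]
      exact g00 c
    rw [this]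
  -- F in closed form
  have hF : (∑ r, ∑ c, ‖∑ a : Fin 2 × Fin 2, conj (w r a) * ∑ m, conj (Q a.1 (m, c)) * φ a.2 m‖ ^ 2)
      = (∑ c, ‖W₁ c‖ ^ 2) + ∑ c, ‖(ρ : ℂ)⁻¹ * (W₂ c - conj (y * x) * W₁ c)‖ ^ 2 := by
    rw [Fin.sum_univ_two]
    simp only [hG0, hG1]
  -- Z values for H
  have hZ00 : ∀ m, (∑ j, conj (w 0 (0, j)) * φ j m) = ψ₁ m := by
    intro m; simp only [Fin.sum_univ_two, w00, w01, map_one, map_zero, one_mul, zero_mul, add_zero, hφ0]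
  have hZ01 : ∀ m, (∑ j, conj (w 0 (1, j)) * φ j m) = 0 := by
    intro m; simp only [Fin.sum_univ_two, w10, w11, map_zero, zero_mul, add_zero]
  have hZ10 : ∀ m, (∑ j, conj (w 1 (0, j)) * φ j m) = (ρ : ℂ)⁻¹ * conj y * (ψ₂ m - conj x * ψ₁ m) := by
    intro m
    simp only [Fin.sum_univ_two, u00, u01, map_zero, zero_mul, zero_add, map_mul, map_inv₀, Complex.conj_ofReal, hφ1]
    rw [show (ρ : ℂ)⁻¹ * (conj y * (σ : ℂ)) * ((σ : ℂ)⁻¹ * (ψ₂ m - conj x * ψ₁ m))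
      = (ρ : ℂ)⁻¹ * conj y * ((σ : ℂ) * (σ : ℂ)⁻¹) * (ψ₂ m - conj x * ψ₁ m) by ring, mul_inv_cancel₀ hσne]
    ring
  have hZ11 : ∀ m, (∑ j, conj (w 1 (1, j)) * φ j m) = (ρ : ℂ)⁻¹ * (τ : ℂ) * ψ₂ m := by
    intro m
    simp only [Fin.sum_univ_two, u10, u11, map_mul, map_inv₀, Complex.conj_ofReal, hφ0, hφ1]
    rw [show (ρ : ℂ)⁻¹ * ((τ : ℂ) * conj x) * ψ₁ m + (ρ : ℂ)⁻¹ * ((τ : ℂ) * (σ : ℂ)) * ((σ : ℂ)⁻¹ * (ψ₂ m - conj x * ψ₁ m))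
      = (ρ : ℂ)⁻¹ * (τ : ℂ) * (conj x * ψ₁ m + ((σ : ℂ) * (σ : ℂ)⁻¹) * (ψ₂ m - conj x * ψ₁ m)) by ring,
      mul_inv_cancel₀ hσne]
    ring
  have hZ0 : ∀ k m, (∑ j, conj (w 0 (k, j)) * φ j m) = if k = 0 then ψ₁ m else 0 := by
    intro k m
    match k with
    | 0 => simpa using hZ00 m
    | 1 => simpa using hZ01 m
  have hZ1 : ∀ k m, (∑ j, conj (w 1 (k, j)) * φ j m)
      = if k = 0 then (ρ : ℂ)⁻¹ * conj y * (ψ₂ m - conj x * ψ₁ m) else (ρ : ℂ)⁻¹ * (τ : ℂ) * ψ₂ m := by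
    intro k m
    match k with
    | 0 => simpa using hZ10 m
    | 1 => simpa using hZ11 m
  have hH : (∑ r, ∑ k, ∑ m, ‖∑ j, conj (w r (k, j)) * φ j m‖ ^ 2)
      = (∑ m, ‖ψ₁ m‖ ^ 2) + ((∑ m, ‖(ρ : ℂ)⁻¹ * conj y * (ψ₂ m - conj x * ψ₁ m)‖ ^ 2)
        + ∑ m, ‖(ρ : ℂ)⁻¹ * (τ : ℂ) * ψ₂ m‖ ^ 2) := by
    rw [Fin.sum_univ_two]
    simp only [hZ0, hZ1]
    simp only [Fin.sum_univ_two, if_true, show ((1 : Fin 2) = 0) = False from by decide, if_false, norm_zero,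
      zero_pow two_ne_zero, Finset.sum_const_zero, add_zero]
  have hNφ : (∑ i, ∑ m, ‖φ i m‖ ^ 2) = (∑ m, ‖ψ₁ m‖ ^ 2) + ∑ m, ‖(σ : ℂ)⁻¹ * (ψ₂ m - conj x * ψ₁ m)‖ ^ 2 := by
    simp only [Fin.sum_univ_two, hφ0, hφ1]
  rw [hF, hH, hNφ] at hA
  -- real expansions
  set A : ℝ := ∑ c, ‖W₁ c‖ ^ 2 with hAdef
  set B : ℝ := ∑ c, ‖W₂ c‖ ^ 2 with hBdef
  set n1 : ℝ := ∑ m, ‖ψ₁ m‖ ^ 2 with hn1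
  set n2 : ℝ := ∑ m, ‖ψ₂ m‖ ^ 2 with hn2
  set Cr : ℝ := (conj (x * y) * ∑ c, conj (W₂ c) * W₁ c).re with hCr
  set qr : ℝ := (conj x * ∑ m, conj (ψ₂ m) * ψ₁ m).re with hqr
  set X : ℝ := ‖x‖ ^ 2 with hX
  set Yn : ℝ := ‖y‖ ^ 2 with hYn
  have hP : ‖y * x‖ ^ 2 = Yn * X := by rw [norm_mul, mul_pow]
  have hP' : ‖x * y‖ ^ 2 = Yn * X := by rw [norm_mul, mul_pow]; ring
  have hX1 : X < 1 := by rw [hX]; nlinarith [norm_nonneg x]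
  have hYX1 : Yn * X < 1 := by rw [← hP]; nlinarith [norm_nonneg (y * x)]
  have E1 : (∑ c, ‖(ρ : ℂ)⁻¹ * (W₂ c - conj (y * x) * W₁ c)‖ ^ 2)
      = (1 - Yn * X)⁻¹ * (B + Yn * X * A - 2 * Cr) := by
    rw [norm_sq_scaled_diff, norm_inv, Complex.norm_real, Real.norm_of_nonneg hρpos.le, inv_pow, hρ2, hP, Complex.norm_conj, hP,
      hCr, mul_comm y x]
  have E2 : (∑ m, ‖(σ : ℂ)⁻¹ * (ψ₂ m - conj x * ψ₁ m)‖ ^ 2) = (1 - X)⁻¹ * (n2 + X * n1 - 2 * qr) := by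
    rw [norm_sq_scaled_diff, norm_inv, Complex.norm_real, Real.norm_of_nonneg hσpos.le, inv_pow, hσ2, Complex.norm_conj]
  have E3 : (∑ m, ‖(ρ : ℂ)⁻¹ * conj y * (ψ₂ m - conj x * ψ₁ m)‖ ^ 2) = (1 - Yn * X)⁻¹ * Yn * (n2 + X * n1 - 2 * qr) := by
    rw [norm_sq_scaled_diff, norm_mul, norm_inv, Complex.norm_real, Real.norm_of_nonneg hρpos.le, mul_pow, inv_pow, hρ2, hP,
      Complex.norm_conj, Complex.norm_conj]
  have E4 : (∑ m, ‖(ρ : ℂ)⁻¹ * (τ : ℂ) * ψ₂ m‖ ^ 2) = (1 - Yn * X)⁻¹ * (1 - Yn) * n2 := by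
    have : (∑ m, ‖(ρ : ℂ)⁻¹ * (τ : ℂ) * ψ₂ m‖ ^ 2) = ‖(ρ : ℂ)⁻¹ * (τ : ℂ)‖ ^ 2 * n2 := by
      rw [hn2, Finset.mul_sum]; exact Finset.sum_congr rfl fun m _ => by rw [norm_mul, mul_pow]
    rw [this, norm_mul, norm_inv, Complex.norm_real, Complex.norm_real, Real.norm_of_nonneg hρpos.le,
      Real.norm_of_nonneg hτpos.le, mul_pow, inv_pow, hρ2, hP, hτ2]
  rw [E1, E2, E3, E4] at hA
  -- the goal in the same variables
  have goalL : (∑ c, ‖∑ m, conj (v₁ (m, c)) * ψ₁ m‖ ^ 2) + (∑ c, ‖∑ m, conj (v₂ (m, c)) * ψ₂ m‖ ^ 2)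
      - 2 * (conj (x * y) * ∑ c, conj (∑ m, conj (v₂ (m, c)) * ψ₂ m) * ∑ m, conj (v₁ (m, c)) * ψ₁ m).re
      = A + B - 2 * Cr := by
    simp only [hAdef, hBdef, hCr, hW₁, hW₂]
  rw [goalL, hP']
  have goalR : ((-(conj x * ((((1 - p') * (1 - Yn * X) / (1 - X) + p' * Yn : ℝ)) : ℂ))) * ∑ m, conj (ψ₂ m) * ψ₁ m).re
      = -(((1 - p') * (1 - Yn * X) / (1 - X) + p' * Yn)) * qr := by
    rw [hqr]
    have : (-(conj x * ((((1 - p') * (1 - Yn * X) / (1 - X) + p' * Yn : ℝ)) : ℂ))) * ∑ m, conj (ψ₂ m) * ψ₁ m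
        = ((-(((1 - p') * (1 - Yn * X) / (1 - X) + p' * Yn)) : ℝ) : ℂ) * (conj x * ∑ m, conj (ψ₂ m) * ψ₁ m) := by
      push_cast; ring
    rw [this, Complex.re_ofReal_mul]
  rw [goalR]
  -- finish
  exact transport_algebra p' X Yn A B Cr n1 n2 qr hX1 hYX1 hA

end Summit.MatrixMultiplication.MatrixMultiplication.Theorems.RankTwoAdditivity
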